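import Literature.NumberTheory.EllipticCurves.ModularCurveGenusBoundProofs
import Literature.NumberTheory.EllipticCurves.ModularCurveGamma0IndexProofs
import Literature.NumberTheory.EllipticCurves.ModularCurveEllipticPointsProofs
import Literature.NumberTheory.EllipticCurves.ModularCurveCuspsProofs
import Mathlib.GroupTheory.Perm.Cycle.Type
import HarnessLib

/-!
# Integrality of the genus formula: `12 ∣ 12 + μ - 3ν₂ - 4ν₃ - 6ν_∞`, i.e. the named fact
  `twelve_mul_genusX0 N` for every `N`, by permutation signs
  (trunk EllArithM, item C17; discharge of a named fact of `ModularCurve.lean`)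

`ModularCurve.lean` defines `genusX0 N = (12 + μ - 3ν₂ - 4ν₃ - 6ν_∞)/12` and states as a named
fact `twelve_mul_genusX0 N : 12 genusX0 N + 3ν₂ + 4ν₃ + 6ν_∞ = 12 + μ` — exactness of the
division (Shimura Prop. 1.40 with Prop. 1.43; Diamond–Shurman Thm. 3.1.1: it is the genus of
`X₀(N)`, an integer, by Riemann–Hurwitz). This file proves it **for every `N ≥ 1` without
`X₀(N)`** (`twelve_mul_genusX0_holds`), as the Riemann–Hurwitz *parity* in its combinatorial
form. Let `X = SL₂(ℤ)/Γ₀(N)` (`μ` elements) with `S`, `T` acting by left multiplication: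

* `ν₂ = #Fix(S)`, `ν₃ = #Fix(TS)` (`ModularCurveEllipticPointsProofs.card_fixed_S_eq_nu₂`,
  `card_fixed_TS_eq_nu₃`), and `ν_∞ = #(⟨T⟩\X)` (`card_orbits_T_eq_nuInfty`: the `⟨T⟩`-orbits
  of `gΓ₀(N)` are the cusps `Γ₀(N)g⁻¹∞`, `ModularCurveCuspsProofs`);
* `S² = (TS)³ = -1` act trivially, so `ν₃ ≡ μ (mod 3)` (orbits of an element of order `3`;
  Mathlib `card_fixedPoints_modEq`), the permutation of `TS` is even, and the permutation of
  `S` has sign `(-1)^{(μ - ν₂)/2}` (Mathlib `sign_of_pow_two_eq_one`);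
* **`sign σ = (-1)^{#X - #(⟨σ⟩\X)}`** for any permutation
  (`sign_eq_neg_one_pow_card_add_card_orbits`:
  the orbits of `⟨σ⟩` are the fixed points and the cycles of `σ`,
  `card_orbits_zpowers_eq`), so the permutation of `T` has sign `(-1)^{μ - ν_∞}`;
* `T = (TS)S⁻¹` gives `sign(T) = sign(S)`, i.e. `(μ - ν₂)/2 ≡ μ - ν_∞ (mod 2)`, i.e.
  `μ + ν₂ + 2ν_∞ ≡ 0 (mod 4)`.

Together, `12 + μ - 3ν₂ - 4ν₃ - 6ν_∞ ≡ 0 (mod 12)`; it is `≥ 0` by Manin's bound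
(`ModularCurveGenusBoundProofs`), whence exactness. (This is the count
`2 - 2g = c(S) + c(TS) + c(T) - μ` of the Euler characteristic of the dessin of `X₀(N) → X(1)`
reduced modulo `2` via `sign = (-1)^{μ - c}`.) Consequently the two named facts of the trunk
coincide: **`twelve_mul_finrank_cuspForm_two (Γ₀(N)) ↔ finrank_cuspForm_two_eq_genusX0 N ↔
genusX0 N ≤ dim S₂(Γ₀(N))`** (`twelve_mul_finrank_cuspForm_two_gamma0_iff`,
`finrank_cuspForm_two_eq_genusX0_iff_le`): all that remains of Diamond–Shurman Thm. 3.5.1 for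
`X₀(N)` is the existence of `g(X₀(N))` linearly independent weight-`2` cusp forms, and the
Eichler–Shimura lattice / `Ω^±_f > 0` chain of `ModularSymbolsManin` runs from that existence
alone (`isZLattice_periodLattice_of_genusX0_le`,
`IsNewform0.plusPeriod_pos_and_minusPeriod_pos_of_genusX0_le`).

## References

* G. Shimura, *Introduction to the arithmetic theory of automorphic functions*, Princeton (1971),
  Prop. 1.40, Prop. 1.43.
* F. Diamond, J. Shurman, *A first course in modular forms*, GTM 228, Springer (2005), Thm. 3.1.1,
  Thm. 3.5.1.
-/

noncomputable section

open scoped MatrixGroups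

open Equiv Equiv.Perm MulAction

namespace Literature.NumberTheory.EllipticCurves.ModularForms

/-! ### Sign of a permutation and the orbits of the cyclic group it generates -/

section Parity

variable {α : Type*} [Fintype α] [DecidableEq α]

omit [Fintype α] [DecidableEq α] in
/-- `y` lies in the `⟨σ⟩`-orbit of `x` iff `σ.SameCycle x y`. [folklore] -/
theorem mem_orbit_zpowers_iff_sameCycle (σ : Perm α) (x y : α) :
    y ∈ MulAction.orbit (Subgroup.zpowers σ) x ↔ σ.SameCycle x y := by
  rw [MulAction.mem_orbit_iff]
  constructor
  · rintro ⟨⟨τ, k, rfl⟩, rfl⟩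
    exact ⟨k, rfl⟩
  · rintro ⟨k, rfl⟩
    exact ⟨⟨σ ^ k, k, rfl⟩, rfl⟩

/-- **The orbits of `⟨σ⟩` are the fixed points of `σ` and the cycles of `σ`**:
`#(α/⟨σ⟩) = #Fix(σ) + #(cycle factors of σ)`. [folklore] -/
theorem card_orbits_zpowers_eq (σ : Perm α) :
    Nat.card (orbitRel.Quotient (Subgroup.zpowers σ) α) =
      Fintype.card (Function.fixedPoints σ) + σ.cycleFactorsFinset.card := by
  classical
  have hwd : ∀ x y : α, σ.SameCycle x y →
      (if hx : σ x = x then (Sum.inl ⟨x, hx⟩ : Function.fixedPoints σ ⊕ σ.cycleFactorsFinset)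
        else Sum.inr ⟨σ.cycleOf x, cycleOf_mem_cycleFactorsFinset_iff.mpr (mem_support.mpr hx)⟩) =
      (if hy : σ y = y then Sum.inl ⟨y, hy⟩
        else Sum.inr ⟨σ.cycleOf y,
          cycleOf_mem_cycleFactorsFinset_iff.mpr (mem_support.mpr hy)⟩) := by
    intro x y hs
    by_cases hx : σ x = x
    · have hy : σ y = y := hs.apply_eq_self_iff.mp hx
      have hxy : x = y := hs.eq_of_left hx
      subst hxy
      rfl
    · have hy : ¬σ y = y := fun h ↦ hx (hs.apply_eq_self_iff.mpr h)
      rw [dif_neg hx, dif_neg hy]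
      congr 2
      exact hs.cycleOf_eq
  let F : orbitRel.Quotient (Subgroup.zpowers σ) α →
      Function.fixedPoints σ ⊕ σ.cycleFactorsFinset :=
    Quotient.lift (fun x ↦ if hx : σ x = x then Sum.inl ⟨x, hx⟩
        else Sum.inr ⟨σ.cycleOf x, cycleOf_mem_cycleFactorsFinset_iff.mpr (mem_support.mpr hx)⟩)
      (fun x y hxy ↦ (hwd y x ((mem_orbit_zpowers_iff_sameCycle σ y x).mp
        (orbitRel_apply.mp hxy))).symm)
  have hF : ∀ x : α, F ⟦x⟧ = if hx : σ x = x then Sum.inl ⟨x, hx⟩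
      else Sum.inr ⟨σ.cycleOf x, cycleOf_mem_cycleFactorsFinset_iff.mpr (mem_support.mpr hx)⟩ :=
    fun x ↦ rfl
  have hbij : Function.Bijective F := by
    constructor
    · intro a b hab
      induction a using Quotient.inductionOn with
      | h x =>
      induction b using Quotient.inductionOn with
      | h y =>
      rw [hF, hF] at hab
      apply Quotient.sound
      -- goal: orbitRel x y, i.e. x ∈ orbit y
      change x ∈ MulAction.orbit (Subgroup.zpowers σ) y
      rw [mem_orbit_zpowers_iff_sameCycle]
      by_cases hx : σ x = x
      · by_cases hy : σ y = y
        · rw [dif_pos hx, dif_pos hy, Sum.inl.injEq, Subtype.mk.injEq] at hab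
          subst hab
          exact SameCycle.refl _ _
        · rw [dif_pos hx, dif_neg hy] at hab
          exact absurd hab (by simp)
      · by_cases hy : σ y = y
        · rw [dif_neg hx, dif_pos hy] at hab
          exact absurd hab (by simp)
        · rw [dif_neg hx, dif_neg hy, Sum.inr.injEq, Subtype.mk.injEq] at hab
          exact (sameCycle_iff_cycleOf_eq_of_mem_support (mem_support.mpr hy)
            (mem_support.mpr hx)).mpr hab.symm
    · rintro (⟨x, hx⟩ | ⟨c, hc⟩)
      · exact ⟨⟦x⟧, by rw [hF, dif_pos (show σ x = x from hx)]⟩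
      · obtain ⟨a, ha⟩ := (mem_cycleFactorsFinset_iff.mp hc).1.nonempty_support
        refine ⟨⟦a⟧, ?_⟩
        have ha' : σ a ≠ a := by
          have := mem_cycleFactorsFinset_support_le hc ha
          exact mem_support.mp this
        rw [hF, dif_neg ha']
        congr 1
        exact Subtype.ext (cycle_is_cycleOf ha hc).symm
  rw [Nat.card_eq_of_bijective F hbij, Nat.card_sum, Nat.card_eq_fintype_card,
    Nat.card_eq_fintype_card,
    Fintype.card_coe]

/-- **Parity of a permutation through its orbits**: `sign σ = (-1)^{#α + #(α/⟨σ⟩)}`, i.e.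
`sign σ = (-1)^{#α - #cycles}` counting fixed points as cycles. [folklore] -/
theorem sign_eq_neg_one_pow_card_add_card_orbits (σ : Perm α) :
    Perm.sign σ =
      (-1) ^ (Fintype.card α + Nat.card (orbitRel.Quotient (Subgroup.zpowers σ) α)) := by
  rw [sign_of_cycleType, card_orbits_zpowers_eq, card_fixedPoints]
  have hle := σ.sum_cycleType_le
  have hc : Multiset.card σ.cycleType = σ.cycleFactorsFinset.card := by
    rw [cycleType, Multiset.card_map, Finset.card_def]
  rw [hc]
  set s := σ.cycleType.sum
  set c := σ.cycleFactorsFinset.card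
  have hmod : (s + c) % 2 = (Fintype.card α + (Fintype.card α - s + c)) % 2 := by omega
  conv_lhs => rw [Int.units_pow_eq_pow_mod_two, hmod]
  exact (Int.units_pow_eq_pow_mod_two _ _).symm

end Parity

/-! ### The coset space `SL₂(ℤ)/Γ₀(N)` -/

section Cosets

open CongruenceSubgroup Matrix.SpecialLinearGroup ModularGroup

variable (N : ℕ) [NeZero N]

/-- An upper triangular element of `SL₂(ℤ)` is `±Tʲ`. [folklore] -/
theorem exists_eq_T_zpow_or_of_apply_one_zero {M : SL(2, ℤ)} (h : M 1 0 = 0) :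
    ∃ j : ℤ, M = T ^ j ∨ M = -T ^ j := by
  have hdet : M 0 0 * M 1 1 = 1 := by
    have := Matrix.det_fin_two (M : Matrix (Fin 2) (Fin 2) ℤ)
    rw [M.det_coe, h, mul_zero, sub_zero] at this
    exact this.symm
  rcases Int.eq_one_or_neg_one_of_mul_eq_one hdet with h00 | h00
  · have h11 : M 1 1 = 1 := by rw [h00, one_mul] at hdet; exact hdet
    refine ⟨M 0 1, Or.inl ?_⟩
    ext i j
    fin_cases i <;> fin_cases j <;> simp [coe_T_zpow, h, h00, h11]
  · have h11 : M 1 1 = -1 := by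
      rw [h00] at hdet; linarith
    refine ⟨-M 0 1, Or.inr ?_⟩
    ext i j
    fin_cases i <;> fin_cases j <;> simp [coe_T_zpow, h, h00, h11]

/-- **The `⟨T⟩`-orbits on `SL₂(ℤ)/Γ₀(N)` are the cusps of `Γ₀(N)`**: `gΓ₀(N) ↦ Γ₀(N)g⁻¹∞` is a
bijection from `⟨T⟩\SL₂(ℤ)/Γ₀(N)` onto `Γ₀(N)\ℙ¹(ℚ)` (Diamond–Shurman §3.8; Shimura §1.6), so their
number is `ν_∞ = ∑_{d ∣ N} φ(gcd(d, N/d))` (`numCusps_eq_nuInfty_holds`). [folklore] -/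
theorem card_orbits_T_eq_nuInfty :
    Nat.card (orbitRel.Quotient (Subgroup.zpowers (T : SL(2, ℤ))) (SL(2, ℤ) ⧸ Gamma0 N)) =
      nuInfty N := by
  rw [← numCusps_eq_nuInfty_holds N, numCusps]
  -- the map `gΓ₀(N) ↦ Γ₀(N) g⁻¹ ∞`
  have hwd : ∀ a b : SL(2, ℤ), (a : SL(2, ℤ) ⧸ Gamma0 N) = b →
      cuspOrbitOf N a⁻¹ = cuspOrbitOf N b⁻¹ := by
    intro a b hab
    rw [QuotientGroup.eq] at hab
    rw [cuspOrbitOf_eq_iff]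
    exact ⟨a⁻¹ * b, hab, by simp⟩
  let ψ : SL(2, ℤ) ⧸ Gamma0 N → CuspOrbits (Gamma0 N : Subgroup (GL (Fin 2) ℝ)) :=
    Quotient.lift (fun g ↦ cuspOrbitOf N g⁻¹) fun a b hab ↦ hwd a b (Quotient.sound hab)
  have hψ : ∀ g : SL(2, ℤ), ψ (g : SL(2, ℤ) ⧸ Gamma0 N) = cuspOrbitOf N g⁻¹ := fun g ↦ rfl
  -- constant on `⟨T⟩`-orbits
  have hT : ∀ (t : Subgroup.zpowers (T : SL(2, ℤ))) (q : SL(2, ℤ) ⧸ Gamma0 N), ψ (t • q) = ψ q := by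
    rintro ⟨t, j, rfl⟩ q
    induction q using QuotientGroup.induction_on with
    | H g =>
      change ψ (((T ^ j * g : SL(2, ℤ))) : SL(2, ℤ) ⧸ Gamma0 N) = ψ g
      rw [hψ, hψ, cuspOrbitOf_eq_iff]
      refine ⟨1, one_mem _, ?_⟩
      simp [mul_inv_rev, coe_T_zpow]
  let ψ' : orbitRel.Quotient (Subgroup.zpowers (T : SL(2, ℤ))) (SL(2, ℤ) ⧸ Gamma0 N) →
      CuspOrbits (Gamma0 N : Subgroup (GL (Fin 2) ℝ)) :=
    Quotient.lift ψ fun a b hab ↦ by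
      obtain ⟨t, rfl⟩ := orbitRel_apply.mp hab
      exact hT t b
  refine Nat.card_eq_of_bijective ψ' ⟨?_, ?_⟩
  · intro a b hab
    induction a using Quotient.inductionOn with
    | h qa =>
    induction b using Quotient.inductionOn with
    | h qb =>
    induction qa using QuotientGroup.induction_on with
    | H g =>
    induction qb using QuotientGroup.induction_on with
    | H h =>
    change ψ g = ψ h at hab
    rw [hψ, hψ, cuspOrbitOf_eq_iff] at hab
    obtain ⟨γ, hγ, hzero⟩ := hab
    rw [inv_inv] at hzero
    -- `g γ h⁻¹ = ± T^j`, so `hΓ₀(N) = T^{-j}·gΓ₀(N)`, i.e. `gΓ₀(N) = T^j·hΓ₀(N)`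
    obtain ⟨j, hj⟩ := exists_eq_T_zpow_or_of_apply_one_zero hzero
    apply Quotient.sound
    refine orbitRel_apply.mpr ⟨⟨T ^ j, j, rfl⟩, ?_⟩
    change ((T ^ j * h : SL(2, ℤ)) : SL(2, ℤ) ⧸ Gamma0 N) = g
    rw [QuotientGroup.eq]
    have hneg1 : (-1 : SL(2, ℤ)) ∈ Gamma0 N := by simp [Gamma0_mem]
    have key : ∃ δ ∈ Gamma0 N, T ^ j * h = g * δ := by
      rcases hj with hj | hj
      · exact ⟨γ, hγ, by rw [← hj, inv_mul_cancel_right]⟩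
      · refine ⟨-γ, by rw [← neg_one_mul]; exact mul_mem hneg1 hγ, ?_⟩
        have hT' : T ^ j = -(g * γ * h⁻¹) := by rw [hj, neg_neg]
        rw [hT', neg_mul, inv_mul_cancel_right, mul_neg]
    obtain ⟨δ, hδ, hkey⟩ := key
    rw [hkey, mul_inv_rev, mul_assoc, inv_mul_cancel, mul_one]
    exact inv_mem hδ
  · rintro c
    obtain ⟨g, rfl⟩ := cuspOrbitOf_surjective N c
    exact ⟨⟦((g⁻¹ : SL(2, ℤ)) : SL(2, ℤ) ⧸ Gamma0 N)⟧, (hψ g⁻¹).trans (by rw [inv_inv])⟩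

/-- `[SL₂(ℤ) : Γ₀(N)] = #(SL₂(ℤ)/Γ₀(N)) = μ`. [folklore] -/
theorem card_coset_eq_gamma0Index : Nat.card (SL(2, ℤ) ⧸ Gamma0 N) = gamma0Index N :=
  index_gamma0_eq_gamma0Index_holds N

end Cosets

/-! ### The congruences `ν₃ ≡ μ (mod 3)` and `μ + ν₂ + 2ν_∞ ≡ 0 (mod 4)` -/

section Congruences

open CongruenceSubgroup Matrix.SpecialLinearGroup ModularGroup

variable (N : ℕ) [NeZero N]

/-- `(TS)³ = -1` in `SL₂(ℤ)`. [folklore] -/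
theorem T_mul_S_pow_three : (T * S) ^ 3 = (-1 : SL(2, ℤ)) := by decide

/-- `S² = -1` in `SL₂(ℤ)`. [folklore] -/
theorem S_pow_two : S ^ 2 = (-1 : SL(2, ℤ)) := by decide

/-- **`ν₃ ≡ μ (mod 3)`**: `TS` acts on the `μ` cosets `SL₂(ℤ)/Γ₀(N)` as a permutation of order
dividing `3` with `ν₃` fixed points (`card_fixed_TS_eq_nu₃`). [folklore] -/
theorem nu₃_modEq_gamma0Index : nu₃ N ≡ gamma0Index N [MOD 3] := by
  classical
  let _ := Fintype.ofFinite (SL(2, ℤ) ⧸ Gamma0 N)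
  let f : Function.End (SL(2, ℤ) ⧸ Gamma0 N) := fun q ↦ (T * S) • q
  have hf : f ^ 3 ^ 1 = 1 := by
    rw [pow_one]
    funext q
    change (T * S) • (T * S) • (T * S) • q = q
    have h3 : (T * S) * (T * S) * (T * S) = (T * S) ^ 3 := by rw [pow_succ, pow_two]
    rw [smul_smul, smul_smul, h3, T_mul_S_pow_three, neg_one_smul_coset]
  have h := Equiv.Perm.card_fixedPoints_modEq (p := 3) (n := 1) hf
  rw [← card_coset_eq_gamma0Index, ← card_fixed_TS_eq_nu₃, Nat.card_eq_fintype_card,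
    Nat.card_eq_fintype_card]
  exact h.symm

/-- **`μ + ν₂ + 2ν_∞ ≡ 0 (mod 4)`**: on the `μ` cosets, `S` is an involution with `ν₂` fixed points,
of sign `(-1)^{(μ - ν₂)/2}`, `TS` has order `3`, hence is even, and `T = (TS)S⁻¹` has sign
`(-1)^{μ - ν_∞}` (`ν_∞` orbits), so `(μ - ν₂)/2 ≡ μ - ν_∞ (mod 2)`. [folklore] -/
theorem gamma0Index_add_nu₂_add_two_mul_nuInfty_mod_four :
    (gamma0Index N + nu₂ N + 2 * nuInfty N) % 4 = 0 := by
  classical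
  let _ := Fintype.ofFinite (SL(2, ℤ) ⧸ Gamma0 N)
  let ρ : SL(2, ℤ) →* Perm (SL(2, ℤ) ⧸ Gamma0 N) := MulAction.toPermHom SL(2, ℤ) _
  have hρ : ∀ (g : SL(2, ℤ)) (q : SL(2, ℤ) ⧸ Gamma0 N), ρ g q = g • q := fun _ _ ↦ rfl
  have hneg : ρ (-1) = 1 := by
    ext q
    rw [hρ, neg_one_smul_coset, Perm.one_apply]
  -- `ρ S` is an involution with `ν₂` fixed points
  have hS2 : ρ S ^ 2 = 1 := by rw [← map_pow, S_pow_two, hneg]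
  have hSfix : Fintype.card (Function.fixedPoints (ρ S)) = nu₂ N := by
    rw [← card_fixed_S_eq_nu₂ N, Nat.card_eq_fintype_card]
    rfl
  have hsignS := Perm.sign_of_pow_two_eq_one hS2
  -- `ρ (TS)` is even
  have hTS : Perm.sign (ρ (T * S)) = 1 := by
    have h3 : Perm.sign (ρ (T * S)) ^ 3 = 1 := by
      rw [← map_pow, ← map_pow, T_mul_S_pow_three, hneg, map_one]
    rcases Int.units_eq_one_or (Perm.sign (ρ (T * S))) with h | h
    · exact h
    · rw [h] at h3
      exact absurd h3 (by decide)
  -- `ρ T` has `ν_∞` orbits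
  have hTorb : Nat.card (orbitRel.Quotient (Subgroup.zpowers (ρ T)) (SL(2, ℤ) ⧸ Gamma0 N)) =
      nuInfty N := by
    rw [← card_orbits_T_eq_nuInfty N]
    have : orbitRel (Subgroup.zpowers (ρ T)) (SL(2, ℤ) ⧸ Gamma0 N) =
        orbitRel (Subgroup.zpowers (T : SL(2, ℤ))) (SL(2, ℤ) ⧸ Gamma0 N) := by
      ext a b
      rw [orbitRel_apply, orbitRel_apply, MulAction.mem_orbit_iff, MulAction.mem_orbit_iff]
      constructor
      · rintro ⟨⟨σ, hσ⟩, rfl⟩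
        obtain ⟨k, rfl⟩ := Subgroup.mem_zpowers_iff.mp hσ
        refine ⟨⟨T ^ k, Subgroup.zpow_mem_zpowers T k⟩, ?_⟩
        change T ^ k • b = (ρ T ^ k) b
        rw [← map_zpow, hρ]
      · rintro ⟨⟨γ, hγ⟩, rfl⟩
        obtain ⟨k, rfl⟩ := Subgroup.mem_zpowers_iff.mp hγ
        refine ⟨⟨ρ T ^ k, Subgroup.zpow_mem_zpowers (ρ T) k⟩, ?_⟩
        change (ρ T ^ k) b = T ^ k • b
        rw [← map_zpow, hρ]
    unfold orbitRel.Quotient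
    rw [this]
  have hsignT := sign_eq_neg_one_pow_card_add_card_orbits (ρ T)
  rw [hTorb] at hsignT
  -- `T = (T S) S⁻¹`
  have hrel : Perm.sign (ρ T) = Perm.sign (ρ S) := by
    have : T = (T * S) * S⁻¹ := by group
    conv_lhs => rw [this, map_mul, map_inv, Perm.sign_mul, Perm.sign_inv, hTS, one_mul]
  -- compare exponents modulo `2`
  have hμ : Fintype.card (SL(2, ℤ) ⧸ Gamma0 N) = gamma0Index N := by
    rw [← Nat.card_eq_fintype_card, card_coset_eq_gamma0Index]
  rw [hsignS, hsignT, hSfix, hμ] at hrel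
  have h2 : 2 ∣ gamma0Index N - nu₂ N ∧ nu₂ N ≤ gamma0Index N := by
    have := Perm.two_dvd_card_support hS2
    constructor
    · have hs : (ρ S).support.card = gamma0Index N - nu₂ N := by
        rw [← hμ, ← hSfix, Perm.card_fixedPoints, Perm.sum_cycleType]
        have := (ρ S).sum_cycleType_le
        rw [Perm.sum_cycleType] at this
        omega
      rwa [hs] at this
    · rw [← hμ, ← hSfix]
      exact set_fintype_card_le_univ _
  obtain ⟨⟨k, hk⟩, hle⟩ := h2
  rw [hk, Nat.mul_div_cancel_left _ two_pos] at hrel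
  -- `hrel : (-1)^(μ + ν∞) = (-1)^k`; compare exponents modulo `2`
  have e1 : ((-1 : ℤˣ) ^ (gamma0Index N + nuInfty N)) =
      (-1) ^ ((gamma0Index N + nuInfty N) % 2) := Int.units_pow_eq_pow_mod_two _ _
  have e2 : ((-1 : ℤˣ) ^ k) = (-1) ^ (k % 2) := Int.units_pow_eq_pow_mod_two _ _
  have h1 : ((-1 : ℤˣ) ^ ((gamma0Index N + nuInfty N) % 2)) = (-1) ^ (k % 2) :=
    e1.symm.trans (hrel.trans e2)
  have hpar : (gamma0Index N + nuInfty N) % 2 = k % 2 := by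
    rcases Nat.mod_two_eq_zero_or_one (gamma0Index N + nuInfty N) with ha | ha <;>
      rcases Nat.mod_two_eq_zero_or_one k with hb | hb <;> simp only [ha, hb] at h1 ⊢ <;>
      exact absurd h1 (by decide)
  omega

end Congruences

/-! ### Integrality: the named fact `twelve_mul_genusX0 N` -/

section Integrality

open CongruenceSubgroup

variable (N : ℕ) [NeZero N]


/-- **Exactness of the genus formula for `X₀(N)`**: `12 g + 3ν₂ + 4ν₃ + 6ν_∞ = 12 + μ` with
`g = genusX0 N = (12 + μ - 3ν₂ - 4ν₃ - 6ν_∞)/12`, i.e. `12 ∣ 12 + μ - 3ν₂ - 4ν₃ - 6ν_∞ ≥ 0`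
(Shimura Prop. 1.40 with Prop. 1.43; Diamond–Shurman Thm. 3.1.1), for every `N ≥ 1`: the
discharge of the named fact `twelve_mul_genusX0` of `ModularCurve.lean`, by the congruences
`ν₃ ≡ μ (mod 3)`, `μ + ν₂ + 2ν_∞ ≡ 0 (mod 4)` (permutation signs on `SL₂(ℤ)/Γ₀(N)`) and
non-negativity from Manin's bound (`ModularCurveGenusBoundProofs`).
[cite: ShimuraIATAF1971, Prop. 1.40 with Prop. 1.43] -/
theorem twelve_mul_genusX0_holds : twelve_mul_genusX0 N := by
  have hle := twelve_mul_finrank_cuspForm_two_add_le_gamma0Index N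
  have h3 := (nu₃_modEq_gamma0Index N)
  have h4 := gamma0Index_add_nu₂_add_two_mul_nuInfty_mod_four N
  unfold Nat.ModEq at h3
  unfold twelve_mul_genusX0 genusX0
  omega

/-- **`12 g(X₀(N)) = 12 + μ - 3ν₂ - 4ν₃ - 6ν_∞` exactly**, for the closed formula `genusX0 N`.
[cite: DiamondShurman2005, Thm. 3.1.1] -/
theorem twelve_mul_genusX0_eq :
    12 * genusX0 N = 12 + gamma0Index N - 3 * nu₂ N - 4 * nu₃ N - 6 * nuInfty N := by
  have h := twelve_mul_genusX0_holds N
  unfold twelve_mul_genusX0 at h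
  omega

/-- **The two named facts coincide**: given Manin's bound and integrality, the
genus-cum-dimension formula `twelve_mul_finrank_cuspForm_two (Γ₀(N))` (`ModularCurveProofs`) is
equivalent to `finrank_cuspForm_two_eq_genusX0 N` (`ModularCurve.lean`), Diamond–Shurman
Thm. 3.5.1 for `X₀(N)`. [cite: DiamondShurman2005, Thm. 3.5.1] -/
theorem twelve_mul_finrank_cuspForm_two_gamma0_iff :
    twelve_mul_finrank_cuspForm_two (Gamma0 N) ↔ finrank_cuspForm_two_eq_genusX0 N := by
  rw [twelve_mul_finrank_cuspForm_two_gamma0_iff_le]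
  have h := twelve_mul_genusX0_holds N
  have hle := finrank_cuspForm_two_le_genusX0 N
  unfold twelve_mul_genusX0 at h
  unfold finrank_cuspForm_two_eq_genusX0
  constructor
  · intro h'
    omega
  · intro h'
    omega

/-- **What remains is existence**: `finrank_cuspForm_two_eq_genusX0 N ↔ genusX0 N ≤ dim S₂(Γ₀(N))`
— the named fact is equivalent to the existence of `g(X₀(N))` linearly independent cusp forms
of weight `2` for `Γ₀(N)` (the Riemann–Roch half of Diamond–Shurman Thm. 3.5.1).
[cite: DiamondShurman2005, Thm. 3.5.1] -/
theorem finrank_cuspForm_two_eq_genusX0_iff_le :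
    finrank_cuspForm_two_eq_genusX0 N ↔ genusX0 N ≤ Module.finrank ℂ (CuspForm (Gamma0 N) 2) := by
  have hle := finrank_cuspForm_two_le_genusX0 N
  unfold finrank_cuspForm_two_eq_genusX0
  omega

/-- **Eichler–Shimura lattice and `Ω^±_f > 0` from the existence of `g(X₀(N))` cusp forms alone**:
the chain `periodHomology_eq_span_basis_of_genus → isZLattice_periodLattice_of_genus →
IsNewform0.plusPeriod_pos_of_genus / minusPeriod_pos_of_genus` of `ModularSymbolsManin` needs only
`genusX0 N ≤ dim S₂(Γ₀(N))` (integrality being proved). [cite: CremonaAlgorithms1997, §2.8] -/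
theorem isZLattice_periodLattice_of_genusX0_le
    (h : genusX0 N ≤ Module.finrank ℂ (CuspForm (Gamma0 N) 2)) {f : CuspForm (Gamma0 N) 2} :
    isZLattice_periodLattice (f := f) :=
  isZLattice_periodLattice_of_genus
    ((twelve_mul_finrank_cuspForm_two_gamma0_iff N).mpr
      ((finrank_cuspForm_two_eq_genusX0_iff_le N).mpr h))

/-- **`Ω⁺_f > 0` and `Ω⁻_f > 0` for a rational newform of level `N`, from
`genusX0 N ≤ dim S₂(Γ₀(N))` and conjugation-stability** (`ModularSymbolsManin`, with the
hypothesis `twelve_mul_finrank_cuspForm_two (Gamma0 N)` replaced by pure existence).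
[cite: CremonaAlgorithms1997, §2.8] -/
theorem IsNewform0.plusPeriod_pos_and_minusPeriod_pos_of_genusX0_le
    (h : genusX0 N ≤ Module.finrank ℂ (CuspForm (Gamma0 N) 2)) {f : CuspForm (Gamma0 N) 2}
    (H₂ : conj_mem_periodLattice (f := f)) :
    IsNewform0.plusPeriod_pos (f := f) ∧ IsNewform0.minusPeriod_pos (f := f) :=
  have h₁ := (twelve_mul_finrank_cuspForm_two_gamma0_iff N).mpr
    ((finrank_cuspForm_two_eq_genusX0_iff_le N).mpr h)
  ⟨IsNewform0.plusPeriod_pos_of_genus h₁ H₂, IsNewform0.minusPeriod_pos_of_genus h₁ H₂⟩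

end Integrality

end Literature.NumberTheory.EllipticCurves.ModularForms

end
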